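import Summits.ValiantsHypothesis.ValiantsHypothesis.Theorems.DepthWindowTruncToeplitz
import Summits.ValiantsHypothesis.ValiantsHypothesis.Theorems.DepthWindowIMMPaths
import HarnessLib

/-!
# Route `DepthWindow`, g8 — the component formula of the `(2,3)` sliver lemma

Third kernel piece (lens-4 NODE-v7 §6 (1)+(2)): chaining `Theorems/DepthWindowTruncToeplitz.lean`
(`[∏ₗ Vₗ]_e` is the `(0, e)` entry of the width-`(d+1)` iterated product of the Toeplitz matrices of
components) with `Theorems/DepthWindowIMMPaths.lean` (path sums and blocks of an iterated matrix
product) gives the explicit `Σ Π^{[a]} Σ Π^{[b]}` expression of the weight-`e` component of a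
product gate of fan-in `a·b` in the components `[Vₗ]_ε`, `ε ≤ d`, of its factors
(`weightedHomogeneousComponent_prod_eq_sum_paths_blocks`), together with the two facts that bound
its size: path weights vanish off weakly increasing weight profiles (`pathWeight_toeplitz_eq_zero`)
and are products of `b` components along them (`pathWeight_toeplitz_of_monotone`).

SCOPE (honest label).  This is the DENSE, position-indexed two-level form: time axis = the `a·b`
factor positions, width `d+1`.  Its size after blocking is `t'^{O(d)}` for fan-in `t' = a·b`, i.e.
it re-derives the regime `t' ≤ 2^{O(d)}` (cf. `Theorems/DepthWindowHomFanIn.lean`) with two product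
layers.  The SLIVER regime `t' ≤ 2^{O(d^{1.5})}` of NODE-v7 §6 needs the SPARSE ABP whose time
axis is the number `k ≤ e` of factors contributing positive weight (state = (weight so far, last
position), width `(d+1)(t'+1)`, `√k × √k` blocking, size `(d t')^{O(√d)}`); for that ABP the
generic path-sum / block lemmas of `Theorems/DepthWindowIMMPaths.lean` (any finite state type) are
the reusable core, and the sparse expansion identity + the gate-level realisation (merging the
inner `Π` with the product layer of the level below, `ΠΠ = Π`, NODE-v7 §6 (4)) are the remaining
pieces.  Pure algebra; nothing here bears on `VP ≠ VNP`.

[cite: LimayeSrinivasanTavenas2025, Lemma 11] [cite: Strassen1973, §3]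
-/

set_option linter.dupNamespace false

namespace Summit.ValiantsHypothesis.ValiantsHypothesis.Theorems.DepthWindow

open MvPolynomial Finset

/-! ### The component formula of the sliver lemma: `[∏ₗ Vₗ]_e` as a two-level path sum -/

section SliverComponents

variable {σ R : Type*} [CommSemiring R]

/-- A Toeplitz path weight vanishes unless the state path is weakly increasing: the matrices
are upper triangular. -/
theorem pathWeight_toeplitz_eq_zero (w : σ → ℕ) (d : ℕ) {t : ℕ} (V : Fin t → MvPolynomial σ R)
    (s : Fin (t + 1) → Fin (d + 1)) (u : Fin t) (hu : s u.succ < s u.castSucc) :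
    pathWeight (fun l => toeplitz w d (V l)) s = 0 := by
  unfold pathWeight
  refine Finset.prod_eq_zero (Finset.mem_univ u) ?_
  show toeplitz w d (V u) (s u.castSucc) (s u.succ) = 0
  rw [toeplitz_apply, if_neg]
  exact Nat.not_le.mpr hu

/-- Along a weakly increasing path the Toeplitz path weight is the product of the components
`[V_l]_{s_{l+1} - s_l}` — a product of fan-in `t` of components of total weight `s_t - s_0`. -/
theorem pathWeight_toeplitz_of_monotone (w : σ → ℕ) (d : ℕ) {t : ℕ}
    (V : Fin t → MvPolynomial σ R) (s : Fin (t + 1) → Fin (d + 1))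
    (hs : ∀ u : Fin t, s u.castSucc ≤ s u.succ) :
    pathWeight (fun l => toeplitz w d (V l)) s =
      ∏ l : Fin t, weightedHomogeneousComponent w ((s l.succ : ℕ) - s l.castSucc) (V l) := by
  unfold pathWeight
  refine Fintype.prod_congr _ _ fun l => ?_
  show toeplitz w d (V l) (s l.castSucc) (s l.succ) = _
  rw [toeplitz_apply, if_pos (show ((s l.castSucc : Fin (d + 1)) : ℕ) ≤ (s l.succ : ℕ) from hs l)]

/-- **Dense two-level component formula (position-indexed; NODE-v7 §6 (1)–(2) in the regime
`t' ≤ 2^{O(d)}` — see the module docstring for the sparse variant the sliver needs).**  For a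
product gate of fan-in `a · b` and `e ≤ d`:
`[∏ₗ Vₗ]_e = ∑_{S : Fin (a+1) → Fin (d+1)} [S₀ = 0] · ∏_{q<a} ( ∑_{s : Fin (b+1) → Fin (d+1)} [s₀ = S_q] ·
  pathWeight (toeplitz ∘ V_{qb+·}) s · [s_b = S_{q+1}] ) · [S_a = e]` — a `Σ Π^{[a]} Σ Π^{[b]}`
expression in the components `[Vₗ]_ε` (`ε ≤ d`; inner path weights vanish off weakly increasing
paths, `pathWeight_toeplitz_eq_zero`, and are products of `b` components along them,
`pathWeight_toeplitz_of_monotone`). [cite: LimayeSrinivasanTavenas2025, Lemma 11] -/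
theorem weightedHomogeneousComponent_prod_eq_sum_paths_blocks (w : σ → ℕ) (d : ℕ) {a b : ℕ}
    (V : Fin (a * b) → MvPolynomial σ R) (e : Fin (d + 1)) :
    weightedHomogeneousComponent w e (∏ l, V l) =
      ∑ S : Fin (a + 1) → Fin (d + 1),
        (if S 0 = 0 then 1 else 0) *
          (∏ q : Fin a, ∑ s : Fin (b + 1) → Fin (d + 1),
            (if s 0 = S q.castSucc then 1 else 0) *
              pathWeight (fun u : Fin b => toeplitz w d (V ⟨(q : ℕ) * b + u, blockIndex_lt q u⟩)) s *
              (if s (Fin.last b) = S q.succ then 1 else 0)) *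
          (if S (Fin.last a) = e then 1 else 0) := by
  classical
  rw [weightedHomogeneousComponent_prod_eq_imm w d V e,
    imm_apply_eq_sum_paths_blocks (fun l => toeplitz w d (V l)) 0 e]

/-- One-level form (no blocks): `[∏ₗ Vₗ]_e = ∑_{s : Fin (t+1) → Fin (d+1)} [s₀ = 0] · pathWeight · [s_t = e]`,
the classical expansion of a truncated product over weakly increasing weight profiles. -/
theorem weightedHomogeneousComponent_prod_eq_sum_paths (w : σ → ℕ) (d : ℕ) {t : ℕ}
    (V : Fin t → MvPolynomial σ R) (e : Fin (d + 1)) :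
    weightedHomogeneousComponent w e (∏ l, V l) =
      ∑ s : Fin (t + 1) → Fin (d + 1),
        (if s 0 = 0 then 1 else 0) * pathWeight (fun l => toeplitz w d (V l)) s *
          (if s (Fin.last t) = e then 1 else 0) := by
  classical
  rw [weightedHomogeneousComponent_prod_eq_imm w d V e,
    imm_apply_eq_sum_paths t (fun l => toeplitz w d (V l)) 0 e]

end SliverComponents

end Summit.ValiantsHypothesis.ValiantsHypothesis.Theorems.DepthWindow
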